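import Summits.ResolutionOfSingularities.ResolutionOfSingularities.Theorems.FrobeniusLadderFRationalResolutionAnRegularOffOrigin
import Summits.ResolutionOfSingularities.ResolutionOfSingularities.Theorems.FrobeniusLadderFRationalResolutionSuspensionNotRegular
import Summits.ResolutionOfSingularities.ResolutionOfSingularities.Theorems.FrobeniusLadderFRationalResolutionSpecHypersurface
import Literature.AlgebraicGeometry.Resolution.CanonicalResolutionProofs
import Literature.AlgebraicGeometry.Resolution.QuasiExcellentSchemes
import HarnessLib

/-!
# The regular locus of the `A_n` surface is the complement of the origin

Support file for crux stmt-ResolutionOfSingularities-15317 (`FrobeniusLadder.FRationalResolution`),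
line `Sketch`, stub `An_mem_regularLocus_iff` (wave 13, theme REC): for every field `k` and every
`n ≥ 1`, a point `q` of `Aₙ = Spec k[y,z,x]/(yz + x^(n+1))` lies in the regular locus `Reg Aₙ`
iff one of the classes `ȳ, z̄, x̄` is not in `q`, i.e. `Reg Aₙ = Aₙ ∖ {origin}`.

* (←) is `An_isRegularLocalRing_stalk_of_notMem` (Jacobian criterion off the origin);
* (→) at the origin `q = (ȳ, z̄, x̄)` the preimage `P` of `q` in `k[y,z,x]` contains all the
  variables, hence equals the maximal ideal `M₀ = (y, z, x)` (`isMaximal_span_range_X`); the stalk is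
  `𝒪_{Aₙ,q} ≅ k[y,z,x]_{M₀}/(g)` (`nonempty_stalk_ringEquiv_localization_quotient`), which is NOT a
  regular local ring since `g = yz + x^(n+1) ∈ M₀²` for `n ≥ 1` (`stub_suspension_not_regular` with
  `f := x^(n+1)`), and regularity transports along ring isomorphisms.

All folklore; no published fact is used.
-/

-- single-problem summit: the doubled namespace component is forced
set_option linter.dupNamespace false

noncomputable section

namespace Summit.ResolutionOfSingularities.ResolutionOfSingularities.Theorems.FRationalResolution

open CategoryTheory AlgebraicGeometry TopologicalSpace
open Literature.AlgebraicGeometry.Resolution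

/-- `x^(n+1)` lies in the square of the origin `(x)` of `k[x]` as soon as `n ≥ 1`. [folklore] -/
theorem X_pow_succ_mem_span_range_X_sq (k : Type) [Field k] (n : ℕ) (hn : 1 ≤ n) :
    (MvPolynomial.X 0 ^ (n + 1) : MvPolynomial (Fin 1) k) ∈
      (Ideal.span (Set.range MvPolynomial.X) : Ideal (MvPolynomial (Fin 1) k)) ^ 2 := by
  have hX0 : (MvPolynomial.X 0 : MvPolynomial (Fin 1) k) ∈
      (Ideal.span (Set.range MvPolynomial.X) : Ideal (MvPolynomial (Fin 1) k)) :=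
    Ideal.subset_span ⟨0, rfl⟩
  obtain ⟨m, hm⟩ : ∃ m, n + 1 = m + 2 := ⟨n - 1, by omega⟩
  rw [hm, pow_add]
  exact Ideal.mul_mem_left _ _ (Ideal.pow_mem_pow hX0 2)

/-- A prime of `k[y,z,x]` containing the three variables is the origin `(y, z, x)`. [folklore] -/
theorem eq_span_range_X_of_X_mem (k : Type) [Field k]
    (P : Ideal (MvPolynomial (Fin 2 ⊕ Fin 1) k)) [P.IsPrime]
    (hy : (MvPolynomial.X (Sum.inl 0) : MvPolynomial (Fin 2 ⊕ Fin 1) k) ∈ P)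
    (hz : (MvPolynomial.X (Sum.inl 1) : MvPolynomial (Fin 2 ⊕ Fin 1) k) ∈ P)
    (hx : (MvPolynomial.X (Sum.inr 0) : MvPolynomial (Fin 2 ⊕ Fin 1) k) ∈ P) :
    P = Ideal.span (Set.range MvPolynomial.X) := by
  have hle : (Ideal.span (Set.range MvPolynomial.X) : Ideal (MvPolynomial (Fin 2 ⊕ Fin 1) k)) ≤ P := by
    rw [Ideal.span_le]
    rintro _ ⟨i, rfl⟩
    rcases i with i | i
    · fin_cases i
      · exact hy
      · exact hz
    · fin_cases i
      exact hx
  exact ((isMaximal_span_range_X k (Fin 2 ⊕ Fin 1)).eq_of_le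
    (Ideal.IsPrime.ne_top inferInstance) hle).symm

/-- **`Reg Aₙ` is the complement of the origin** (stub `An_mem_regularLocus_iff` of line `Sketch`,
crux stmt-ResolutionOfSingularities-15317). For a field `k`, `n ≥ 1` and a point `q` of
`Aₙ = Spec k[y,z,x]/(yz + x^(n+1))`: `q ∈ Reg Aₙ` iff one of `ȳ, z̄, x̄` is not in `q`.
(←) `An_isRegularLocalRing_stalk_of_notMem`; (→) at the origin the stalk is
`≅ k[y,z,x]_{(y,z,x)}/(g)` (`nonempty_stalk_ringEquiv_localization_quotient`), not regular because
`g ∈ 𝔪²` (`stub_suspension_not_regular` with `f = x^(n+1)`, `n + 1 ≥ 2`). [folklore] -/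
theorem An_mem_regularLocus_iff (k : Type) [Field k] (n : ℕ) (hn : 1 ≤ n)
    (q : Spec (CommRingCat.of (MvPolynomial (Fin 2 ⊕ Fin 1) k ⧸ Ideal.span
      {(MvPolynomial.X (Sum.inl 0) * MvPolynomial.X (Sum.inl 1) +
        MvPolynomial.rename Sum.inr (MvPolynomial.X 0 ^ (n + 1)) : MvPolynomial (Fin 2 ⊕ Fin 1) k)}))) :
    q ∈ Scheme.regularLocus (Spec (CommRingCat.of (MvPolynomial (Fin 2 ⊕ Fin 1) k ⧸ Ideal.span
      {(MvPolynomial.X (Sum.inl 0) * MvPolynomial.X (Sum.inl 1) +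
        MvPolynomial.rename Sum.inr (MvPolynomial.X 0 ^ (n + 1)) : MvPolynomial (Fin 2 ⊕ Fin 1) k)}))) ↔
    (Ideal.Quotient.mk _ (MvPolynomial.X (Sum.inl 0)) ∉ q.asIdeal ∨
      Ideal.Quotient.mk _ (MvPolynomial.X (Sum.inl 1)) ∉ q.asIdeal ∨
      Ideal.Quotient.mk _ (MvPolynomial.X (Sum.inr 0)) ∉ q.asIdeal) := by
  refine ⟨fun hreg => ?_, fun h => An_isRegularLocalRing_stalk_of_notMem k n q h⟩
  by_contra h
  rw [not_or, not_or, not_not, not_not, not_not] at h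
  obtain ⟨hy, hz, hx⟩ := h
  haveI hPprime : (q.asIdeal.comap (Ideal.Quotient.mk (Ideal.span
      {(MvPolynomial.X (Sum.inl 0) * MvPolynomial.X (Sum.inl 1) +
        MvPolynomial.rename Sum.inr (MvPolynomial.X 0 ^ (n + 1)) :
          MvPolynomial (Fin 2 ⊕ Fin 1) k)}))).IsPrime :=
    Ideal.comap_isPrime _ _
  -- the preimage of the origin of `Aₙ` is the origin `(y, z, x)` of `k[y,z,x]`
  have hPeq : q.asIdeal.comap (Ideal.Quotient.mk (Ideal.span
      {(MvPolynomial.X (Sum.inl 0) * MvPolynomial.X (Sum.inl 1) +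
        MvPolynomial.rename Sum.inr (MvPolynomial.X 0 ^ (n + 1)) :
          MvPolynomial (Fin 2 ⊕ Fin 1) k)})) = Ideal.span (Set.range MvPolynomial.X) :=
    eq_span_range_X_of_X_mem k _ hy hz hx
  haveI hPmax : (q.asIdeal.comap (Ideal.Quotient.mk (Ideal.span
      {(MvPolynomial.X (Sum.inl 0) * MvPolynomial.X (Sum.inl 1) +
        MvPolynomial.rename Sum.inr (MvPolynomial.X 0 ^ (n + 1)) :
          MvPolynomial (Fin 2 ⊕ Fin 1) k)}))).IsMaximal :=
    hPeq ▸ isMaximal_span_range_X k (Fin 2 ⊕ Fin 1)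
  -- `k[y,z,x]_{(y,z,x)}/(g)` is not regular: `g = yz + x^(n+1) ∈ 𝔪²`
  obtain ⟨_, hnot⟩ := (stub_suspension_not_regular k 1 (MvPolynomial.X 0 ^ (n + 1))
    (pow_ne_zero _ (MvPolynomial.X_ne_zero 0)) (X_pow_succ_mem_span_range_X_sq k n hn)).2 _ hPeq
  -- transport along `𝒪_{Aₙ,q} ≃+* k[y,z,x]_P/(g)`
  obtain ⟨e⟩ := nonempty_stalk_ringEquiv_localization_quotient _ _ q _ rfl
  haveI : IsRegularLocalRing ((Spec (CommRingCat.of (MvPolynomial (Fin 2 ⊕ Fin 1) k ⧸ Ideal.span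
      {(MvPolynomial.X (Sum.inl 0) * MvPolynomial.X (Sum.inl 1) +
        MvPolynomial.rename Sum.inr (MvPolynomial.X 0 ^ (n + 1)) :
          MvPolynomial (Fin 2 ⊕ Fin 1) k)}))).presheaf.stalk q) := hreg
  exact hnot (IsRegularLocalRing.of_ringEquiv e)

end Summit.ResolutionOfSingularities.ResolutionOfSingularities.Theorems.FRationalResolution

end
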